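import Summits.Ventures.PackingBounds.Configurations.ListConfig
import Summits.Ventures.PackingBounds.Configurations.QuarticTwoInt

/-!
# The square antiprism: `8` points on `S²` with minimal angle `74.8585°` (Tammes `N = 8`, attained side), over `ℤ[2^{1/4}]`

Framing: lottery ticket; floor = certified bounds/negative ranges. Venture `PackingBounds` (cell
`pub-packcert`, seat `pub-packcert-recog`) — the **attained side** of the Tammes problem for `N = 8` and of
the sharp three-point bound `A(3, (2√2 - 1)/7) ≤ 8` of Dostert–de Laat–Moustrou (the control object of the
cell's T3 programme).

The optimal `8`-point configuration (Schütte–van der Waerden 1951) is the square antiprism whose side edges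
equal the square edges: vertices `(±2, 0, α), (0, ±2, α)` and `(±α², ±α², -α)` with `α = 2^{1/4}`
(squared length `4 + α² = 4 + √2`). All coordinates lie in `ℤ[α]` (`Configurations/QuarticTwoInt.lean`);
the kernel computes the dot products in `ℤ[α]`: every vertex sees `α²` (×4: two square neighbours, two
antiprism neighbours), `-3α²` (×2) and `α² - 4` (×1), i.e. cosines `(2√2 - 1)/7 = 0.2612…` (×4),
`-3(2√2 - 1)/7` (×2), `-(2√2 - 1)²/7` (×1) — the inner-product list of Dostert–de Laat–Moustrou 2021, §4.
Consequence (Mathlib-only statement): `exists_code_8`, `8` unit vectors of `ℝ³` with pairwise inner products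
`≤ (2√2 - 1)/7`, i.e. `A(3, (2√2 - 1)/7) ≥ 8`, `θ(8) ≥ arccos((2√2 - 1)/7) = 74.8585°`. Optimality is not
asserted here.

## References
* K. Schütte, B. L. van der Waerden, *Auf welcher Kugel haben 5, 6, 7, 8 oder 9 Punkte mit Mindestabstand Eins
  Platz?*, Math. Ann. 123 (1951) 96–124. [`SchutteVanderwaerden1951`]
* M. Dostert, D. de Laat, P. Moustrou, *Exact semidefinite programming bounds for packing problems*, SIAM J.
  Optim. 31 (2021) 1433–1458, Thm 4.4. [`DostertDelaatMoustrou2021`]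
-/

namespace Summit.Ventures.PackingBounds.Config.SquareAntiprism

open Finset Summit.Ventures.PackingBounds.Config Summit.Ventures.PackingBounds.Config.QuarticTwoInt

/-- The `8` vertices `(±2, 0, α), (0, ±2, α), (±α², ±α², -α)` of the square antiprism over `ℤ[α]`, `α⁴ = 2`.
[cite: DostertDelaatMoustrou2021, Thm 4.4] -/
def vecs : List (List QuarticTwoInt) := [
  [⟨2, 0, 0, 0⟩, ⟨0, 0, 0, 0⟩, ⟨0, 1, 0, 0⟩],
  [⟨-2, 0, 0, 0⟩, ⟨0, 0, 0, 0⟩, ⟨0, 1, 0, 0⟩],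
  [⟨0, 0, 0, 0⟩, ⟨2, 0, 0, 0⟩, ⟨0, 1, 0, 0⟩],
  [⟨0, 0, 0, 0⟩, ⟨-2, 0, 0, 0⟩, ⟨0, 1, 0, 0⟩],
  [⟨0, 0, 1, 0⟩, ⟨0, 0, 1, 0⟩, ⟨0, -1, 0, 0⟩],
  [⟨0, 0, 1, 0⟩, ⟨0, 0, -1, 0⟩, ⟨0, -1, 0, 0⟩],
  [⟨0, 0, -1, 0⟩, ⟨0, 0, 1, 0⟩, ⟨0, -1, 0, 0⟩],
  [⟨0, 0, -1, 0⟩, ⟨0, 0, -1, 0⟩, ⟨0, -1, 0, 0⟩]]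

/-- The common squared length `q = 4 + α²` (`= 4 + √2`). -/
def q : QuarticTwoInt := ⟨4, 0, 1, 0⟩

/-- The distance table: dot products `α² - 4` (×1), `-3α²` (×2), `α²` (×4). -/
def table : List (QuarticTwoInt × ℕ) := [(⟨-4, 0, 1, 0⟩, 1), (⟨0, 0, -3, 0⟩, 2), (⟨0, 0, 1, 0⟩, 4)]

/-- Kernel check: `8` coordinate lists. -/
theorem length_vecs : vecs.length = 8 := by decide +kernel

set_option maxRecDepth 100000 in
/-- Kernel check: every list has length `3` and squared length `q`. -/
private theorem shape_vecs : shapeOK vecs 3 q = true := by decide +kernel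

/-- Kernel check: the table keys are distinct and differ from `q`. -/
private theorem keys_table : keysOK table q = true := by decide +kernel

set_option maxRecDepth 100000 in
/-- Kernel check (the distance distribution in `ℤ[α]`). -/
private theorem hist_vecs : histOK vecs table vecs = true := by decide +kernel

/-- The coordinate lists are pairwise distinct (from the checks). -/
private theorem nodup_vecs : vecs.Nodup := nodup_of_checks shape_vecs keys_table hist_vecs

/-- The configuration: the normalised vertices as points of `ℝ³`. -/
noncomputable def pts : Finset (EuclideanSpace ℝ (Fin 3)) := config toReal 3 q vecs

/-- `(√2)² = 2`. -/
private theorem hX : Real.sqrt 2 ^ 2 = 2 := Real.sq_sqrt (by norm_num)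

/-- `1.41421 < √2 < 1.41422`. -/
private theorem sqrt2_bounds : (1.41421 : ℝ) < Real.sqrt 2 ∧ Real.sqrt 2 < 1.41422 :=
  ⟨(Real.lt_sqrt (by norm_num)).mpr (by norm_num), (Real.sqrt_lt' (by norm_num)).mpr (by norm_num)⟩

/-- `ι q = 4 + √2 > 0`. -/
private theorem hq : 0 < toReal q := by
  rw [toReal_apply, q, alpha_sq]; push_cast; nlinarith [sqrt2_bounds.1]

/-- Every key `d` satisfies `ι d / ι q ≤ (2√2 - 1)/7` (with equality for the largest key `α²`). -/
private theorem keys_le : ∀ p ∈ table, toReal p.1 / toReal q ≤ (2 * Real.sqrt 2 - 1) / 7 := by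
  have h1 := sqrt2_bounds.1; have h2 := sqrt2_bounds.2; have h3 := hX
  intro p hp
  rw [div_le_div_iff₀ hq (by norm_num : (0 : ℝ) < 7), toReal_apply, toReal_apply, q]
  simp only [table, List.mem_cons, List.not_mem_nil, or_false] at hp
  rcases hp with rfl | rfl | rfl <;> push_cast <;> simp only [alpha_sq, zero_mul, add_zero, zero_add] <;>
    nlinarith

/-- `(2√2 - 1)/7 < 1`. -/
private theorem smax_lt : (2 * Real.sqrt 2 - 1) / 7 < 1 := by
  nlinarith [sqrt2_bounds.2]

/-- `pts` has `8` points. -/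
theorem card_pts : pts.card = 8 := by
  rw [pts, config, ← length_vecs, List.toFinset_card_of_nodup, List.length_map]
  refine nodup_vecs.map_on fun l hl l' hl' he => ?_
  by_contra hne
  obtain ⟨p, hp, hpe⟩ := inner_vec_mem hq shape_vecs hist_vecs hl hl' hne
  rw [he, real_inner_self_eq_norm_sq, norm_vec toReal 3 q hq l' (length_of_shapeOK shape_vecs hl')
    (dot_self_of_shapeOK shape_vecs hl'), one_pow] at hpe
  have h := keys_le p hp
  rw [← hpe] at h
  linarith [smax_lt]

/-- Every point of `pts` is a unit vector. -/
theorem norm_pts : ∀ x ∈ pts, ‖x‖ = 1 := norm_eq_one hq shape_vecs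

/-- Pairwise inner products of `pts` are `≤ (2√2 - 1)/7`. -/
theorem inner_pts : ∀ x ∈ pts, ∀ y ∈ pts, x ≠ y → inner ℝ x y ≤ (2 * Real.sqrt 2 - 1) / 7 :=
  inner_le hq shape_vecs hist_vecs _ keys_le

/-- **Tammes `N = 8`, attained side: `A(3, (2√2 - 1)/7) ≥ 8`** — `8` unit vectors of `ℝ³` (the square
antiprism) with pairwise inner products `≤ (2√2 - 1)/7 = 0.26120…`, i.e. pairwise angles `≥ 74.8585°`.
[cite: DostertDelaatMoustrou2021, Thm 4.4] -/
theorem exists_code_8 : ∃ C : Finset (EuclideanSpace ℝ (Fin 3)), C.card = 8 ∧ (∀ x ∈ C, ‖x‖ = 1) ∧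
    ∀ x ∈ C, ∀ y ∈ C, x ≠ y → inner ℝ x y ≤ (2 * Real.sqrt 2 - 1) / 7 :=
  ⟨pts, card_pts, norm_pts, inner_pts⟩

end Summit.Ventures.PackingBounds.Config.SquareAntiprism
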